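import Summits.Ventures.CertifiedArithmetic.LowPrec.GemmThetaLawGenE2M3Check1
import Summits.Ventures.CertifiedArithmetic.LowPrec.GemmThetaLawGenE2M3Check2
import Summits.Ventures.CertifiedArithmetic.LowPrec.GemmThetaLawGenE2M3Check3
import Summits.Ventures.CertifiedArithmetic.LowPrec.GemmThetaLawGenE2M3Check4
import Summits.Ventures.CertifiedArithmetic.LowPrec.GemmThetaLawGenE2M3Check5
import Summits.Ventures.CertifiedArithmetic.LowPrec.GemmThetaLawGenE2M3Check6
import Summits.Ventures.CertifiedArithmetic.LowPrec.GemmThetaLawGenE2M3Check7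
import Summits.Ventures.CertifiedArithmetic.LowPrec.GemmThetaLawGenE2M3Check8
import Summits.Ventures.CertifiedArithmetic.LowPrec.GemmThetaLawGenE2M3Check9
import Summits.Ventures.CertifiedArithmetic.LowPrec.GemmThetaLawGenE2M3Check10
import Summits.Ventures.CertifiedArithmetic.LowPrec.GemmThetaLawGenE2M3Check11

/-!
# The E2M3×E2M3 law check passes for every `p ≥ 12`

HONEST FRAMING (venture CertifiedArithmetic / cell `pub-lowprec`, seat gemm, gen 13): certified
error envelopes and provably optimal rounding/accumulation schemes for low-precision formats under
stated cost models; every table by two implementations; no hardware or vendor claims.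

`lawCheck_e2m3`: the letter-dependent symbolic θ-certificate check of the E2M3×E2M3 law
(`GemmThetaLawGenE2M3Data.e2m3Law`: `J = 11`, `θ = (5M + 8)/252 = (5·2^(p-3) + 2)/63`, `ρ = 63/2`,
`β_pair = 191/2`) passes — all 46,348 classes, their pair tables and all coverage chains —
assembled from the per-level kernel theorems of `GemmThetaLawGenE2M3Data.lean` and
`GemmThetaLawGenE2M3Check1..11.lean` (levels above 2400 classes from their two sign halves).
`GemmThetaLawGenE2M3Cert.lean` turns it into the θ-certificate (SUP side of t:thetap6 (E2M3 row))
for every `p ≥ 12` by the landed soundness theorem `LawData.lawCheck_cert`. [cell]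
-/

namespace Literature.ComputerArithmetic.FloatingPoint

namespace MiniFloat

namespace ThetaLaw

/-- Level `Q` of the E2M3×E2M3 law check passes (4410 classes: the two sign halves). [cell] -/
theorem levCheck_e2m3_Q : e2m3Law.levCheck Lev.Q = true := by
  unfold LawData.levCheck
  simp only [List.all_cons, List.all_nil, Bool.and_true, Bool.and_eq_true]
  exact ⟨levCheck_e2m3_Q_pos, levCheck_e2m3_Q_neg⟩

/-- Level `bin 0` of the E2M3×E2M3 law check passes (4388 classes: the two sign halves). [cell] -/
theorem levCheck_e2m3_b0 : e2m3Law.levCheck (Lev.bin 0) = true := by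
  unfold LawData.levCheck
  simp only [List.all_cons, List.all_nil, Bool.and_true, Bool.and_eq_true]
  exact ⟨levCheck_e2m3_b0_pos, levCheck_e2m3_b0_neg⟩

/-- Level `bin 1` of the E2M3×E2M3 law check passes (4344 classes: the two sign halves). [cell] -/
theorem levCheck_e2m3_b1 : e2m3Law.levCheck (Lev.bin 1) = true := by
  unfold LawData.levCheck
  simp only [List.all_cons, List.all_nil, Bool.and_true, Bool.and_eq_true]
  exact ⟨levCheck_e2m3_b1_pos, levCheck_e2m3_b1_neg⟩

/-- Level `bin 2` of the E2M3×E2M3 law check passes (4272 classes: the two sign halves). [cell] -/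
theorem levCheck_e2m3_b2 : e2m3Law.levCheck (Lev.bin 2) = true := by
  unfold LawData.levCheck
  simp only [List.all_cons, List.all_nil, Bool.and_true, Bool.and_eq_true]
  exact ⟨levCheck_e2m3_b2_pos, levCheck_e2m3_b2_neg⟩

/-- Level `bin 3` of the E2M3×E2M3 law check passes (4152 classes: the two sign halves). [cell] -/
theorem levCheck_e2m3_b3 : e2m3Law.levCheck (Lev.bin 3) = true := by
  unfold LawData.levCheck
  simp only [List.all_cons, List.all_nil, Bool.and_true, Bool.and_eq_true]
  exact ⟨levCheck_e2m3_b3_pos, levCheck_e2m3_b3_neg⟩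

/-- Level `bin 4` of the E2M3×E2M3 law check passes (3972 classes: the two sign halves). [cell] -/
theorem levCheck_e2m3_b4 : e2m3Law.levCheck (Lev.bin 4) = true := by
  unfold LawData.levCheck
  simp only [List.all_cons, List.all_nil, Bool.and_true, Bool.and_eq_true]
  exact ⟨levCheck_e2m3_b4_pos, levCheck_e2m3_b4_neg⟩

/-- Level `bin 5` of the E2M3×E2M3 law check passes (3718 classes: the two sign halves). [cell] -/
theorem levCheck_e2m3_b5 : e2m3Law.levCheck (Lev.bin 5) = true := by
  unfold LawData.levCheck
  simp only [List.all_cons, List.all_nil, Bool.and_true, Bool.and_eq_true]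
  exact ⟨levCheck_e2m3_b5_pos, levCheck_e2m3_b5_neg⟩

/-- Level `bin 6` of the E2M3×E2M3 law check passes (3412 classes: the two sign halves). [cell] -/
theorem levCheck_e2m3_b6 : e2m3Law.levCheck (Lev.bin 6) = true := by
  unfold LawData.levCheck
  simp only [List.all_cons, List.all_nil, Bool.and_true, Bool.and_eq_true]
  exact ⟨levCheck_e2m3_b6_pos, levCheck_e2m3_b6_neg⟩

/-- Level `bin 7` of the E2M3×E2M3 law check passes (3082 classes: the two sign halves). [cell] -/
theorem levCheck_e2m3_b7 : e2m3Law.levCheck (Lev.bin 7) = true := by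
  unfold LawData.levCheck
  simp only [List.all_cons, List.all_nil, Bool.and_true, Bool.and_eq_true]
  exact ⟨levCheck_e2m3_b7_pos, levCheck_e2m3_b7_neg⟩

/-- Level `bin 8` of the E2M3×E2M3 law check passes (2752 classes: the two sign halves). [cell] -/
theorem levCheck_e2m3_b8 : e2m3Law.levCheck (Lev.bin 8) = true := by
  unfold LawData.levCheck
  simp only [List.all_cons, List.all_nil, Bool.and_true, Bool.and_eq_true]
  exact ⟨levCheck_e2m3_b8_pos, levCheck_e2m3_b8_neg⟩

/-- Level `bin 9` of the E2M3×E2M3 law check passes (2460 classes: the two sign halves). [cell] -/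
theorem levCheck_e2m3_b9 : e2m3Law.levCheck (Lev.bin 9) = true := by
  unfold LawData.levCheck
  simp only [List.all_cons, List.all_nil, Bool.and_true, Bool.and_eq_true]
  exact ⟨levCheck_e2m3_b9_pos, levCheck_e2m3_b9_neg⟩

/-- The levels of the E2M3×E2M3 law, explicitly. [cell] -/
theorem levels_e2m3 : e2m3Law.levels =
    [Lev.Q, Lev.bin 0, Lev.bin 1, Lev.bin 2, Lev.bin 3, Lev.bin 4, Lev.bin 5, Lev.bin 6,
      Lev.bin 7, Lev.bin 8, Lev.bin 9, Lev.bin 10, Lev.bin 11, Lev.top] := by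
  decide

/-- THE E2M3×E2M3 LAW CHECK PASSES for every `p ≥ 12`. [cell, kernel; assembled] -/
theorem lawCheck_e2m3 : e2m3Law.lawCheck = true := by
  unfold LawData.lawCheck
  rw [levels_e2m3, sideOK_e2m3]
  simp only [List.all_cons, List.all_nil,
    levCheck_e2m3_Q, levCheck_e2m3_b0, levCheck_e2m3_b1, levCheck_e2m3_b2, levCheck_e2m3_b3,
    levCheck_e2m3_b4, levCheck_e2m3_b5, levCheck_e2m3_b6, levCheck_e2m3_b7, levCheck_e2m3_b8,
    levCheck_e2m3_b9, levCheck_e2m3_b10, levCheck_e2m3_b11, levCheck_e2m3_top,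
    Bool.and_self]

end ThetaLaw

end MiniFloat

end Literature.ComputerArithmetic.FloatingPoint
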